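import Mathlib.Analysis.Complex.AbsMax
import Mathlib.Analysis.SpecificLimits.Basic
import Mathlib.Analysis.SpecialFunctions.Log.Basic
import HarnessLib

/-!
# Dominated exponential sums of holomorphic levels: rigidity, density of strict dominance, rates

Analysis/Complex support file (everything proved; no definitions, no named facts).  Elementary
facts about finitely many holomorphic zero-free "levels" `lam j` (`j : ι`, `ι` finite) on a disc
`ball c R` with envelope `Λ = max_j ‖lam j‖` (given through `‖lam j‖ ≤ Λ`, attained), as they occur
in transfer-matrix expansions `Z_t = Σ_j n_j λ_j^t + O((θΛ)^t)` of strip / tube partition functions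
(the setting of the Beraha–Kahane–Weiss theorem, cf. `EquimodularZeroAccumulation.lean`):

* `norm_eq_norm_of_eqOn_ball`: two holomorphic functions on `ball c R`, the second zero-free,
  with equal moduli on a small ball have equal moduli on the whole disc (maximum modulus principle `Complex.eqOn_of_isPreconnected_of_isMaxOn_norm` for the
  quotient + identity theorem `AnalyticOnNhd.eqOn_of_preconnected_of_eventuallyEq`).
* `exists_mem_forall_norm_lt` (density of strict dominance): if no two levels have moduli in a
  constant ratio on the disc, every open `W ⊆ ball c R` meeting the disc contains a point at which
  ONE level is strictly larger in modulus than all others — at a point of `W` with the fewest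
  maximal levels the maximal set is locally constant, and two maximal levels would have equal
  moduli on a ball, which the rigidity lemma turns into proportionality on the disc.
* `tendsto_log_norm_div_nat` (rate): if `‖Z_t − Σ_j n_j λ_j^t‖ ≤ C (θ Λ)^t` (`θ < 1`, `n_j ≥ 1`)
  at a point where level `i` is strictly dominant and `Z_t ≠ 0`, then `t⁻¹ log ‖Z_t‖ → log |λ_i|`
  (`Z_t = n_i λ_i^t (1 + w_t)` with `w_t → 0` geometrically).

Used by `Summits/QuantumFields/YangMills/Theorems/ComplexCouplingChannelTubeZeroFreeChannelStubDominanceOfZeroFree.lean`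
(zero-freeness of `Z_t` for all large `t` forces the centre-dominant level to dominate the disc).
Everything here is standard and tagged folklore (S. Beraha, J. Kahane, N. J. Weiss, *Limits of
zeroes of recursively defined families of polynomials*, Adv. in Math. Suppl. Stud. 1 (1978),
213–232; A. D. Sokal, *Chromatic roots are dense in the whole complex plane*, Combin. Probab.
Comput. 13 (2004), 221–261, §3).
-/

noncomputable section

open Filter Metric Set Topology
open _root_.Complex

namespace Literature.Analysis.Complex

/-! ### Two levels of equal modulus near a point are proportional on the disc -/

/-- **Rigidity of equal moduli.**  If `l₁, l₂` are holomorphic on `ball c R`, `l₂` is zero-free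
there, and `‖l₁‖ = ‖l₂‖` on a ball `ball z₀ δ ⊆ ball c R` (`δ > 0`), then `‖l₁‖ = ‖l₂‖` on the
whole of `ball c R`: the quotient `l₁ / l₂` has constant modulus `1` near `z₀`, hence is constant
there (maximum modulus principle) and on `ball c R` (identity theorem). [folklore] -/
theorem norm_eq_norm_of_eqOn_ball {l₁ l₂ : ℂ → ℂ} {c z₀ : ℂ} {R δ : ℝ}
    (h₁ : DifferentiableOn ℂ l₁ (ball c R)) (h₂ : DifferentiableOn ℂ l₂ (ball c R))
    (hne₂ : ∀ z ∈ ball c R, l₂ z ≠ 0) (hδ : 0 < δ) (hsub : ball z₀ δ ⊆ ball c R)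
    (heq : ∀ w ∈ ball z₀ δ, ‖l₁ w‖ = ‖l₂ w‖) :
    ∀ z ∈ ball c R, ‖l₁ z‖ = ‖l₂ z‖ := by
  have hz₀ : z₀ ∈ ball c R := hsub (mem_ball_self hδ)
  set q : ℂ → ℂ := fun z => l₁ z / l₂ z with hq
  have hqd : DifferentiableOn ℂ q (ball c R) := h₁.div h₂ hne₂
  have hq1 : ∀ w ∈ ball z₀ δ, ‖q w‖ = 1 := fun w hw => by
    rw [hq, norm_div, heq w hw, div_self (norm_ne_zero_iff.2 (hne₂ w (hsub hw)))]
  have hmax : IsMaxOn (norm ∘ q) (ball z₀ δ) z₀ := fun w hw => by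
    simp only [Function.comp_apply, mem_setOf_eq, hq1 w hw, hq1 z₀ (mem_ball_self hδ), le_refl]
  have hloc : EqOn q (Function.const ℂ (q z₀)) (ball z₀ δ) :=
    Complex.eqOn_of_isPreconnected_of_isMaxOn_norm (convex_ball z₀ δ).isPreconnected isOpen_ball
      (hqd.mono hsub) (mem_ball_self hδ) hmax
  have hev : q =ᶠ[𝓝 z₀] Function.const ℂ (q z₀) :=
    Filter.eventuallyEq_of_mem (isOpen_ball.mem_nhds (mem_ball_self hδ)) hloc
  have hglob : EqOn q (Function.const ℂ (q z₀)) (ball c R) :=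
    (hqd.analyticOnNhd isOpen_ball).eqOn_of_preconnected_of_eventuallyEq analyticOnNhd_const
      (convex_ball c R).isPreconnected hz₀ hev
  intro z hz
  have h1 : l₁ z = q z * l₂ z := by rw [hq]; exact (div_mul_cancel₀ _ (hne₂ z hz)).symm
  rw [h1, norm_mul, hglob hz, Function.const_apply, hq1 z₀ (mem_ball_self hδ), one_mul]

/-! ### Density of the points with a strictly dominant level -/

/-- **Points with a strictly dominant level are dense.**  For finitely many holomorphic zero-free
levels `lam j` on `ball c R` with envelope `Λ` (`‖lam j‖ ≤ Λ`, attained), no two of which have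
moduli in a constant ratio on the disc, every open `W ⊆ ball c R` containing a point `z₀` contains
a point at which ONE level is strictly larger in modulus than all the others.  (At a point of `W`
with the fewest maximal levels the maximal set is locally constant; if it had two elements, two
levels would have equal moduli on a ball, hence on the disc by `norm_eq_norm_of_eqOn_ball` —
excluded.) [folklore] -/
theorem exists_mem_forall_norm_lt {ι : Type*} [Fintype ι] {lam : ι → ℂ → ℂ} {Λ : ℂ → ℝ}
    {c : ℂ} {R : ℝ} (hlamd : ∀ j, DifferentiableOn ℂ (lam j) (ball c R))
    (hlam : ∀ j, ∀ z ∈ ball c R, lam j z ≠ 0 ∧ ‖lam j z‖ ≤ Λ z)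
    (henv : ∀ z ∈ ball c R, ∃ j, ‖lam j z‖ = Λ z)
    (hnd : ∀ i j, i ≠ j → ¬ ∃ a : ℝ, ∀ z ∈ ball c R, ‖lam i z‖ = a * ‖lam j z‖)
    {W : Set ℂ} (hW : IsOpen W) (hWR : W ⊆ ball c R) {z₀ : ℂ} (hz₀ : z₀ ∈ W) :
    ∃ z ∈ W, ∃ i, ∀ i', i' ≠ i → ‖lam i' z‖ < ‖lam i z‖ := by
  classical
  -- the number of maximal levels, minimised over `W`
  set cnt : ℂ → ℕ := fun z => (Finset.univ.filter fun i => ‖lam i z‖ = Λ z).card with hcnt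
  have hP : ∃ m, ∃ z ∈ W, cnt z = m := ⟨cnt z₀, z₀, hz₀, rfl⟩
  obtain ⟨z, hzW, hzm⟩ := Nat.find_spec hP
  have hmin : ∀ w ∈ W, cnt z ≤ cnt w := fun w hw => by
    rw [hzm]; exact Nat.find_min' hP ⟨w, hw, rfl⟩
  have hzR : z ∈ ball c R := hWR hzW
  set S : Finset ι := Finset.univ.filter fun i => ‖lam i z‖ = Λ z with hS
  have hmemS : ∀ i, i ∈ S ↔ ‖lam i z‖ = Λ z := fun i => by simp [hS]
  obtain ⟨i₀, hi₀⟩ := henv z hzR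
  have hi₀S : i₀ ∈ S := (hmemS i₀).2 hi₀
  -- near `z`: inside `W`, and the non-maximal levels stay below level `i₀`
  have hev : ∀ᶠ w in 𝓝 z, w ∈ W ∧ ∀ i, i ∉ S → ‖lam i w‖ < ‖lam i₀ w‖ := by
    refine (Filter.eventually_mem_set.2 (hW.mem_nhds hzW)).and ?_
    refine Filter.eventually_all.2 fun i => ?_
    by_cases hiS : i ∈ S
    · exact Filter.Eventually.of_forall fun w h => absurd hiS h
    · have hlt : ‖lam i z‖ < ‖lam i₀ z‖ := by
        rw [hi₀]
        exact lt_of_le_of_ne (hlam i z hzR).2 (fun h => hiS ((hmemS i).2 h))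
      have hci : ContinuousAt (fun w => ‖lam i w‖) z :=
        ((hlamd i).continuousOn.continuousAt (isOpen_ball.mem_nhds hzR)).norm
      have hci₀ : ContinuousAt (fun w => ‖lam i₀ w‖) z :=
        ((hlamd i₀).continuousOn.continuousAt (isOpen_ball.mem_nhds hzR)).norm
      exact (hci.eventually_lt hci₀ hlt).mono fun w hw _ => hw
  obtain ⟨δ, hδ, hball⟩ := Metric.eventually_nhds_iff_ball.1 hev
  have hsubR : ball z δ ⊆ ball c R := fun w hw => hWR (hball w hw).1
  -- on `ball z δ` every level of `S` is maximal
  have hSw : ∀ w ∈ ball z δ, ∀ i ∈ S, ‖lam i w‖ = Λ w := by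
    intro w hw i hi
    obtain ⟨hwW, hlt⟩ := hball w hw
    have hwR : w ∈ ball c R := hWR hwW
    set Sw : Finset ι := Finset.univ.filter fun i => ‖lam i w‖ = Λ w with hSw
    have hmemSw : ∀ i, i ∈ Sw ↔ ‖lam i w‖ = Λ w := fun i => by simp [hSw]
    have hsub : Sw ⊆ S := by
      intro i' hi'
      by_contra hi'S
      have h1 : ‖lam i' w‖ = Λ w := (hmemSw i').1 hi'
      have h2 := hlt i' hi'S
      have h3 := (hlam i₀ w hwR).2
      linarith
    have hcard : S.card ≤ Sw.card := by
      have := hmin w hwW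
      simpa only [hcnt] using this
    have heqS : Sw = S := Finset.eq_of_subset_of_card_le hsub hcard
    exact (hmemSw i).1 (heqS ▸ hi)
  by_cases hex : ∃ i ∈ S, i ≠ i₀
  · -- two maximal levels of equal modulus on a ball: excluded
    obtain ⟨i₁, hi₁S, hi₁⟩ := hex
    exfalso
    have heq : ∀ w ∈ ball z δ, ‖lam i₁ w‖ = ‖lam i₀ w‖ := fun w hw => by
      rw [hSw w hw i₁ hi₁S, hSw w hw i₀ hi₀S]
    exact hnd i₁ i₀ hi₁ ⟨1, fun w hw => (one_mul ‖lam i₀ w‖).symm ▸ norm_eq_norm_of_eqOn_ball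
      (hlamd i₁) (hlamd i₀) (fun w hw => (hlam i₀ w hw).1) hδ hsubR heq w hw⟩
  · -- `S = {i₀}`: level `i₀` is strictly dominant at `z`
    push Not at hex
    refine ⟨z, hzW, i₀, fun i' hi' => ?_⟩
    have hi'S : i' ∉ S := fun h => hi' (hex i' h)
    rw [hi₀]
    exact lt_of_le_of_ne (hlam i' z hzR).2 (fun h => hi'S ((hmemS i').2 h))

/-! ### The rate at a point with a strictly dominant level -/

/-- **Rate of a dominated exponential sum at a point with a strictly dominant level.**  If
`‖Z_t − Σ_j n_j λ_j^t‖ ≤ C (θ Λ)^t` (`t ≥ t₀`, `0 ≤ θ < 1`, `n_j ≥ 1`), `Λ = |λ_i|` and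
`|λ_{i'}| < |λ_i| ≠ 0` for `i' ≠ i`, and `Z_t ≠ 0` for `t ≥ t₀`, then `t⁻¹ log ‖Z_t‖ → log |λ_i|`
(`Z_t = n_i λ_i^t (1 + w_t)` with `w_t → 0`). [folklore] -/
theorem tendsto_log_norm_div_nat {ι : Type*} [Fintype ι] [DecidableEq ι] {Zt : ℕ → ℂ}
    {lamz : ι → ℂ} {n : ι → ℕ} {C θ Λz : ℝ} {t₀ : ℕ} {i : ι}
    (hn : ∀ j, 0 < n j) (hθ : 0 ≤ θ) (hθ1 : θ < 1) (hΛ : Λz = ‖lamz i‖)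
    (hi : ∀ i', i' ≠ i → ‖lamz i'‖ < ‖lamz i‖)
    (hdom : ∀ t : ℕ, t₀ ≤ t → ‖Zt t - ∑ j, (n j : ℂ) * lamz j ^ t‖ ≤ C * (θ * Λz) ^ t)
    (hzf : ∀ t : ℕ, t₀ ≤ t → Zt t ≠ 0) (ha : lamz i ≠ 0) :
    Tendsto (fun t : ℕ => Real.log ‖Zt t‖ / t) atTop (𝓝 (Real.log ‖lamz i‖)) := by
  set a : ℝ := ‖lamz i‖ with ha_def
  have ha0 : 0 < a := norm_pos_iff.2 ha
  have hni : (0 : ℝ) < n i := by exact_mod_cast hn i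
  have hdom' : ∀ t : ℕ, t₀ ≤ t → ‖Zt t - ∑ j, (n j : ℂ) * lamz j ^ t‖ ≤ C * (θ * a) ^ t := by
    intro t ht
    have h := hdom t ht
    rwa [hΛ] at h
  -- the principal term
  set P : ℕ → ℂ := fun t => (n i : ℂ) * lamz i ^ t with hP
  have hP0 : ∀ t, P t ≠ 0 := fun t =>
    mul_ne_zero (Nat.cast_ne_zero.2 (hn i).ne') (pow_ne_zero _ ha)
  have hPn : ∀ t, ‖P t‖ = n i * a ^ t := fun t => by
    simp only [hP, norm_mul, norm_pow, Complex.norm_natCast, ha_def]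
  -- the relative correction and its bound
  set w : ℕ → ℂ := fun t => (Zt t - P t) / P t with hw
  have hZ : ∀ t, Zt t = P t * (1 + w t) := fun t => by
    simp only [hw]
    field_simp [hP0 t]
    ring
  set b : ℕ → ℝ := fun t => C / n i * θ ^ t +
    ∑ j ∈ Finset.univ.erase i, (n j : ℝ) / n i * (‖lamz j‖ / a) ^ t with hb
  have hb0 : Tendsto b atTop (𝓝 0) := by
    have h1 : Tendsto (fun t : ℕ => C / n i * θ ^ t) atTop (𝓝 (C / n i * 0)) :=
      (tendsto_pow_atTop_nhds_zero_of_lt_one hθ hθ1).const_mul _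
    have h2 : Tendsto (fun t : ℕ => ∑ j ∈ Finset.univ.erase i, (n j : ℝ) / n i * (‖lamz j‖ / a) ^ t)
        atTop (𝓝 (∑ j ∈ Finset.univ.erase i, (n j : ℝ) / n i * 0)) := by
      refine tendsto_finsetSum _ fun j hj => ?_
      have hj' : j ≠ i := Finset.ne_of_mem_erase hj
      have hr1 : ‖lamz j‖ / a < 1 := (div_lt_one ha0).2 (hi j hj')
      exact (tendsto_pow_atTop_nhds_zero_of_lt_one (div_nonneg (norm_nonneg _) ha0.le)
        hr1).const_mul _
    have h := h1.add h2
    simpa [hb] using h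
  have hwb : ∀ t, t₀ ≤ t → ‖w t‖ ≤ b t := by
    intro t ht
    have hsplit : Zt t - P t = (Zt t - ∑ j, (n j : ℂ) * lamz j ^ t) +
        ∑ j ∈ Finset.univ.erase i, (n j : ℂ) * lamz j ^ t := by
      rw [← Finset.add_sum_erase Finset.univ (fun j => (n j : ℂ) * lamz j ^ t) (Finset.mem_univ i)]
      simp only [hP]
      ring
    have hden : (0 : ℝ) < n i * a ^ t := mul_pos hni (pow_pos ha0 _)
    show ‖(Zt t - P t) / P t‖ ≤ b t
    rw [norm_div, hPn, hsplit, div_le_iff₀ hden]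
    calc ‖(Zt t - ∑ j, (n j : ℂ) * lamz j ^ t) + ∑ j ∈ Finset.univ.erase i, (n j : ℂ) * lamz j ^ t‖
        ≤ ‖Zt t - ∑ j, (n j : ℂ) * lamz j ^ t‖
            + ‖∑ j ∈ Finset.univ.erase i, (n j : ℂ) * lamz j ^ t‖ := norm_add_le _ _
      _ ≤ C * (θ * a) ^ t + ∑ j ∈ Finset.univ.erase i, (n j : ℝ) * ‖lamz j‖ ^ t := by
          refine add_le_add (hdom' t ht) ((norm_sum_le _ _).trans (le_of_eq ?_))
          refine Finset.sum_congr rfl fun j _ => ?_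
          rw [norm_mul, norm_pow, Complex.norm_natCast]
      _ = b t * (n i * a ^ t) := by
          simp only [hb]
          rw [add_mul, Finset.sum_mul]
          congr 1
          · rw [mul_pow]
            field_simp
          · refine Finset.sum_congr rfl fun j _ => ?_
            rw [div_pow]
            field_simp
  have hw0 : Tendsto w atTop (𝓝 0) :=
    squeeze_zero_norm' (eventually_atTop.2 ⟨t₀, hwb⟩) hb0
  have hlog1 : Tendsto (fun t => Real.log ‖1 + w t‖) atTop (𝓝 0) := by
    have h1 : Tendsto (fun t => ‖1 + w t‖) atTop (𝓝 1) := by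
      have h := ((tendsto_const_nhds (x := (1 : ℂ))).add hw0).norm
      simpa using h
    have h2 := (Real.continuousAt_log one_ne_zero).tendsto.comp h1
    simpa [Function.comp_def, Real.log_one] using h2
  -- the exact formula for `t ≥ max t₀ 1`
  have hformula : ∀ t : ℕ, max t₀ 1 ≤ t →
      Real.log a + (Real.log (n i) + Real.log ‖1 + w t‖) * (t : ℝ)⁻¹ = Real.log ‖Zt t‖ / t := by
    intro t ht
    have ht₀ : t₀ ≤ t := le_trans (le_max_left _ _) ht
    have htpos : (0 : ℝ) < t := by
      exact_mod_cast lt_of_lt_of_le Nat.one_pos (le_trans (le_max_right _ _) ht)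
    have h1w : 1 + w t ≠ 0 := by
      intro h0
      exact hzf t ht₀ (by rw [hZ t, h0, mul_zero])
    have hnorm : ‖Zt t‖ = n i * a ^ t * ‖1 + w t‖ := by rw [hZ t, norm_mul, hPn]
    rw [hnorm, Real.log_mul (mul_pos hni (pow_pos ha0 _)).ne' (norm_ne_zero_iff.2 h1w),
      Real.log_mul hni.ne' (pow_pos ha0 _).ne', Real.log_pow]
    field_simp
    ring
  have hlim : Tendsto (fun t : ℕ =>
      Real.log a + (Real.log (n i) + Real.log ‖1 + w t‖) * (t : ℝ)⁻¹) atTop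
      (𝓝 (Real.log a + (Real.log (n i) + 0) * 0)) :=
    tendsto_const_nhds.add ((tendsto_const_nhds.add hlog1).mul tendsto_inv_atTop_nhds_zero_nat)
  rw [mul_zero, add_zero] at hlim
  exact hlim.congr' (eventually_atTop.2 ⟨max t₀ 1, hformula⟩)

end Literature.Analysis.Complex
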